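import Summits.HodgeConjecture.HodgeConjecture.Theorems.H413E2SWIdentityCloseFibreCMFrame
import Summits.HodgeConjecture.HodgeConjecture.Theorems.H413E2SWFrameOfRecordCM
import Summits.HodgeConjecture.HodgeConjecture.Theorems.H413E2SWSplitPlaceTorusIdele
import Summits.HodgeConjecture.HodgeConjecture.Theorems.H413E2SWSiegelWeilCM
import Summits.HodgeConjecture.HodgeConjecture.Theorems.H413E2SWFrameHyperplaneCM
import Summits.HodgeConjecture.HodgeConjecture.Theorems.H413E2SWBorelBoundCMImpl
import Summits.HodgeConjecture.HodgeConjecture.Theorems.H413E2SWBorelBoundLettersCM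
import Literature.NumberTheory.Automorphic.QuadraticExtensionSplitPlaceExists
import HarnessLib

/-!
# H413 · E-2 · SW2 (iii) — I-CLOSE: `hfib_CM` CLOSED (the `hFIB` binder of ★ `siegelWeil_weilRange_CM_of_fib`)

Cell `hodgecm-mathlib`, crux H413 (`stmt-HodgeConjecture-24833`), child line `Cruxes/H413/Lines/F0_E2SiegelWeilWeilRange.lean` ED. 8∕9,
stub `stub_SW2iii_siegelWeil`, identity half; F0P4-plan (g5) ORDER OF THE CLOSE 2026-08-31T06:16:45Z, fuse 06:22:41Z.  KERNEL MATHEMATICS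
ONLY (no definition, no `sorry`).  HC_CM is proved only modulo the 7 printed citations until rung 0 closes.

WHAT THIS FILE DOES.  The statement is the `hFIB` binder of ★ `E2SWSiegelWeilCM.siegelWeil_weilRange_CM_of_fib` (F0P4-p06), VERBATIM: for
every `b : F` and every nonnegative compactly supported `Θ ∈ 𝒮_ℝ(X□(𝔸))` the theta-side fibre measure of `Λ_θ,ℝ` along `h = hNorm` and Weil's
`μ_b = E_X|_{h = b}` integrate `Θ` proportionally with the constant `ν(univ)` [Weil1965, Chap. V n° 50 (39)–(40), n° 52 Thm 5].  The proof is
B-p03 (g23)'s pre-flight assembly (c1b74087): ★ (T5) `E2SWIdentityCloseFibreCMFrame.hfib_CM_of_frame` on the frame of record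
(★ `E2SWFrameOfRecord.exists_frame_of_record`, `exists_differenceFunctional`, F0P4-p01) at a split place (★ `exists_split_place'`) with the one-place
torus ideles (★ `E2SWSplitPlaceFrame.exists_onePlaceTorusIdele`, A-p01), with its two sockets now filled BY NAME:
* (S-3E) `hS3E` := ★ `E2SWFrameHyperplaneCM.hS3E_of_hNorm` (F0P4-p08 (g4): `E_X` does not charge the coordinate hyperplanes of a split frame,
  ★ `Literature.NumberTheory.Weil1965.adelicSiegelMeasure_frameHyperplane_eq_zero`, over B-p08 (g18)'s hNorm letters ★ `E2SWSplitPlaceFrame`);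
* (**)′ `hBOUND` := ★ A6c′ `E2SWBorelBoundCMImpl.exists_borelBound_hBOUND_of_implementerHom` (F0P4-p07 (g3)) fed the implementer hom
  ★ `E2SWBorelBoundLettersCM.exists_implementerHom_CM_of` (F0P4-p05 (g3): Weil 1964 n° 41 Lemme 5 domination transported along the
  congruence diagonalising `T_V`).
The `example` at the end is the plug test into ★ `siegelWeil_weilRange_CM_of_fib`.

## References
* [Weil1965] A. Weil, *Sur la formule de Siegel dans la théorie des groupes classiques*, Acta Math. 113 (1965), Chap. V n° 50 (39)–(40)
  p. 74; Chap. VI n° 52 Théorème 5 pp. 76–77; Chap. IV n° 41 (35) p. 59.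
* [Weil1964] A. Weil, *Sur certains groupes d'opérateurs unitaires*, Acta Math. 111 (1964), Chap. I n° 13 p. 160; Chap. III n° 41 Lemme 5.
-/

set_option autoImplicit false
-- the cell's `Summit.HodgeConjecture.HodgeConjecture.…` namespace repeats the summit name by design (D-0017 layout)
set_option linter.dupNamespace false

noncomputable section

open MeasureTheory NumberField Filter Topology Set IsDedekindDomain
open scoped NNReal ENNReal Matrix ComplexConjugate ComplexOrder
open Literature.NumberTheory.Automorphic Literature.NumberTheory.Automorphic.AdelicVector
open Literature.NumberTheory.Weil1964 Literature.NumberTheory.Weil1965 Literature.NumberTheory.Weil1965.UnitaryDoubling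
open Literature.NumberTheory.GaloisRepresentations.IsNonarchimedeanLocalField
open Literature.RepresentationTheory.HeisenbergGroup
open Literature.NumberTheory.Automorphic.DoubledUnitary.RankOneReduction
open Literature.NumberTheory.Automorphic.UnitaryGroup
open Literature.NumberTheory.Automorphic.UnitaryGroup.QuadraticCoordinates
open Literature.NumberTheory.GelbartRogawski1991 Literature.NumberTheory.GelbartRogawski1991.UnitaryDualPair
open Summit.HodgeConjecture.HodgeConjecture.Cruxes.H413
open Summit.HodgeConjecture.HodgeConjecture.Cruxes.H413.E2SWBorelBoundFrame


namespace Summit.HodgeConjecture.HodgeConjecture.Cruxes.H413.E2SWIdentityCloseFibreCMFinal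

/-- **`hfib_CM` — THE FIBREWISE PROPORTIONALITY `∫ Θ dμ̂_b = ν(univ) · ∫ Θ dμ_b` AT THE CM ∕ UNITARY DATUM, CLOSED** (the `hFIB` binder of ★
`E2SWSiegelWeilCM.siegelWeil_weilRange_CM_of_fib`, VERBATIM): ★ (T5) `hfib_CM_of_frame` on the frame of record at a split place, with
`hS3E` := ★ `hS3E_of_hNorm` and `hBOUND` := ★ `exists_borelBound_hBOUND_of_implementerHom` ∘ ★ `exists_implementerHom_CM_of`.
[cite: Weil1965, Chap. V n° 50, (39)–(40), p. 74] [cite: Weil1965, Chap. VI n° 52, Théorème 5, pp. 76–77] [cite: Weil1964, Chap. I n° 13 p. 160] -/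
theorem hfib_CM :
    ∀ (F E : Type) [Field F] [NumberField F] [Field E] [NumberField E] [Algebra F E]
      (c : E ≃ₐ[F] E) (N : ℕ) {n : ℕ} (e : Fin N × Fin 1 ≃ Fin n)
      {TV : Matrix (Fin N) (Fin N) F} {TW : Matrix (Fin 1) (Fin 1) F}
      [Algebra.IsQuadraticExtension F E]
      [IsTotallyReal F] [IsTotallyComplex E] (τ : E →+* ℂ) (hτ : ((TV.map (algebraMap F E)).map τ).PosDef)
      {δ : E} (hcδ : c δ = -δ) (hδ : δ ≠ 0) {d : F}
      (hd : δ * δ = algebraMap F E d) (hV : TV.IsSymm) (hW : TW.IsSymm) (hVd : IsUnit TV.det) (hWd : IsUnit TW.det)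
      [LocallyCompactSpace (UnitaryGroup.adelic F E c N (TV.map (algebraMap F E)))]
      [LocallyCompactSpace (UnitaryGroup.adelic F E c 1 (TW.map (algebraMap F E)))]
      (s : UnitaryGroup.adelicPair F E c N 1 (TV.map (algebraMap F E)) (TW.map (algebraMap F E)) →*
        adelicMpCont F (Fin n) (adelicGram F e TV TW))
      (hs : (splittingDatum F E c N 1 e (TV.map (algebraMap F E)) (TW.map (algebraMap F E)) hcδ hδ hd hV hW hVd hWd rfl rfl).IsCompatible s)
      [CompactSpace (UnitaryGroup.adelic F E c N (TV.map (algebraMap F E)) ⧸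
        (UnitaryGroup.toAdelic F E c N (TV.map (algebraMap F E))).range)]
      [CompactSpace (UnitaryGroup.adelic F E c 1 (TW.map (algebraMap F E)) ⧸
        (UnitaryGroup.toAdelic F E c 1 (TW.map (algebraMap F E))).range)]
      [MeasurableSpace (UnitaryGroup.adelic F E c N (TV.map (algebraMap F E)) ⧸
        (UnitaryGroup.toAdelic F E c N (TV.map (algebraMap F E))).range)]
      [BorelSpace (UnitaryGroup.adelic F E c N (TV.map (algebraMap F E)) ⧸
        (UnitaryGroup.toAdelic F E c N (TV.map (algebraMap F E))).range)]
      (ν : Measure (UnitaryGroup.adelic F E c N (TV.map (algebraMap F E)) ⧸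
        (UnitaryGroup.toAdelic F E c N (TV.map (algebraMap F E))).range))
      [IsFiniteMeasure ν] [ν.IsOpenPosMeasure]
      [SMulInvariantMeasure (UnitaryGroup.adelic F E c N (TV.map (algebraMap F E)))
        (UnitaryGroup.adelic F E c N (TV.map (algebraMap F E)) ⧸ (UnitaryGroup.toAdelic F E c N (TV.map (algebraMap F E))).range) ν]
      [MeasurableSpace (AdeleRing (𝓞 F) F)] [BorelSpace (AdeleRing (𝓞 F) F)]
      (νX : Measure (Fin n → AdeleRing (𝓞 F) F)) [νX.IsAddHaarMeasure]
      (hiso : ∀ (p : UnitaryGroup.adelic F E c N (TV.map (algebraMap F E)) × UnitaryGroup.adelic F E c 1 (TW.map (algebraMap F E)))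
          (Φ : piSchwartzBruhat F (Fin n)),
        ∫⁻ x, ‖((pairRep F E c N 1 e (TV.map (algebraMap F E)) (TW.map (algebraMap F E)) s) p Φ :
            (Fin n → AdeleRing (𝓞 F) F) → ℂ) x‖ₑ ^ 2 ∂νX =
          ∫⁻ x, ‖(Φ : (Fin n → AdeleRing (𝓞 F) F) → ℂ) x‖ₑ ^ 2 ∂νX),
      2 < N →
      ∀ [MeasurableSpace (adeleQuotient F)] [BorelSpace (adeleQuotient F)]
        (νE : Measure (Fin (n + n) → AdeleRing (𝓞 F) F)) [νE.IsAddHaarMeasure]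
        (hνE : νE (piFundamentalDomain F (Fin (n + n))) = 1)
        (h : (Fin (n + n) → AdeleRing (𝓞 F) F) → AdeleRing (𝓞 F) F) (hh : Continuous h)
        (hhN : ∀ x, h x = hNorm F E c hcδ hδ N e TV hVd TW hWd x)
        (hB : ∀ Φ ∈ piSchwartzBruhat F (Fin (n + n)), Summable fun ξ : F => ‖adelicSiegelCoeff F (Fin (n + n)) νE h Φ ξ‖),
    ∀ (b : F) (Θ : piSchwartzBruhatReal F (Fin (n + n))), 0 ≤ (Θ : (Fin (n + n) → AdeleRing (𝓞 F) F) → ℝ) →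
          HasCompactSupport (Θ : (Fin (n + n) → AdeleRing (𝓞 F) F) → ℝ) →
          ∫ x, (Θ : (Fin (n + n) → AdeleRing (𝓞 F) F) → ℝ) x ∂(fibreMeasure F (Fin (n + n)) (thetaOrbitFunctionalReal F E c hcδ hδ hd N e TV hV hVd TW hW hWd ν)
                (thetaOrbitFunctionalReal_nonneg F E c hcδ hδ hd N e TV hV hVd TW hW hWd ν) h b) =
            (ν Set.univ).toReal * ∫ x, (Θ : (Fin (n + n) → AdeleRing (𝓞 F) F) → ℝ) x ∂(adelicSiegelFibreMeasure F (Fin (n + n)) νE h hh hB b) := by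
  intro F E _ _ _ _ _ c N n e TV TW _ _ _ τ hτ δ hcδ hδ d hd hV hW hVd hWd _ _ s hs _ _ _ _ ν _ _ _ _ _ νX _ hiso hN _ _ νE _ hνE h hh hhN hB
  -- the frame-of-record letters (★ `E2SWFrameOfRecord`)
  haveI : IsGalois F E := E2SWFrameOfRecord.isGalois
  have h2 := E2SWFrameOfRecord.algEquiv_eq_one_or_eq_conj (F := F) hcδ hδ
  have hTW := E2SWFrameOfRecord.entry_ne_zero_of_isUnit_det_one (F := F) hWd
  have hW2 := E2SWFrameOfRecord.isSymm_doubledLine (F := F) hW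
  have hTs := E2SWFrameOfRecord.isSymm_adelicGram (F := F) e hV hW
  obtain ⟨u₀, jS, j, M, hu₀, hjS, hj, hM⟩ :=
    E2SWFrameOfRecord.exists_frame_of_record F E c hcδ hδ hd N e TV hV hVd TW hWd hW2 νE hTW
  obtain ⟨E'', hE''⟩ := E2SWFrameOfRecord.exists_differenceFunctional F E c hcδ hδ hd N e TV hV hVd TW hW hWd ν νE h hh hB
  -- a split place `v` (★ `exists_split_place'`), Borel structure and a Haar measure on `F_v`
  obtain ⟨v, sd, hsd⟩ := Literature.NumberTheory.Automorphic.QuadraticExtension.exists_split_place' F E c hcδ hδ hd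
  letI : MeasurableSpace (v.adicCompletion F) := borel _
  haveI : BorelSpace (v.adicCompletion F) := ⟨rfl⟩
  -- `n = N ≥ 3`, so `Fin n` is nonempty
  have hNn : N = n := by simpa [Fintype.card_prod, Fintype.card_fin] using Fintype.card_congr e
  haveI : Nonempty (Fin n) := ⟨⟨0, by omega⟩⟩
  -- (S-3E) `hS3E` := ★ `E2SWFrameHyperplaneCM.hS3E_of_hNorm` (F0P4-p08 (g4) p813169 over ★ p812949 + ★ B-p08 p812985)
  have hS3E := E2SWFrameHyperplaneCM.hS3E_of_hNorm F E c hcδ hδ hd N e TV hVd TW hWd νE h hh hhN hB v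
    (MeasureTheory.Measure.addHaar : Measure (v.adicCompletion F))
  -- (**)′ `hBOUND` := ★ A6c′ `exists_borelBound_hBOUND_of_implementerHom` ∘ ★ (B) `exists_implementerHom_CM_of` (F0P4-p07 (g3), F0P4-p05 (g3))
  have hBOUND := E2SWBorelBoundCMImpl.exists_borelBound_hBOUND_of_implementerHom F E c hcδ hδ hd N e TV hV hVd TW hW hWd hW2 ν νE h hh
    hN hνE hhN hB h2 hTW hTs u₀ hu₀ jS hjS j hj E'' hE''
    (fun Φ => E2SWBorelBoundLettersCM.exists_implementerHom_CM_of F E c hcδ hδ hd N e TV TW hV hW2 hVd hWd u₀ Φ)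
  -- ★ (T5) with the two sockets (S-3E) `hS3E` and (**)′ `hBOUND`
  exact E2SWIdentityCloseFibreCMFrame.hfib_CM_of_frame F E c hcδ hδ hd N e TV hV hVd TW hW hWd hW2 ν νE h hh τ hτ hN hhN hB
    h2 hTW hTs u₀ hu₀ jS hjS j hj hM E'' hE'' hBOUND v hsd MeasureTheory.Measure.addHaar hS3E
    (fun r hr => E2SWSplitPlaceFrame.exists_onePlaceTorusIdele F E c hcδ hδ hd v hsd r hr)

/-- plug test: `hfib_CM` IS the `hFIB` binder of ★ `siegelWeil_weilRange_CM_of_fib` (the SW2(iii) identity half follows in p06's ED. 3).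
[cite: Weil1965, Chap. VI n° 52, Théorème 5, pp. 76–77] -/
example := E2SWSiegelWeilCM.siegelWeil_weilRange_CM_of_fib hfib_CM

end Summit.HodgeConjecture.HodgeConjecture.Cruxes.H413.E2SWIdentityCloseFibreCMFinal

end
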